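/-
COR-CM (cells pub-hodgecm ∕ pub-hodgecm2, stage 2 of the Hodge ladder) — Δ2 BRIDGE, TOP ROW «Ω AT δ′» (COORDINATOR Δ2 PRIORITY SHIFT
2026-08-23 16:42Z; ASSEMBLER DECISION #7 (1)): THE LIU REST AT THE ε-NORMALISER OF RECORD `δ′ := (2δ_F)⁻¹` AND THE X3-ω PINS
`σ ∕ hσ ∕ e ∕ he` (R1) DISCHARGED THERE.
WHY δ′ = (2δ_F)⁻¹ (referee OBJECT-MATCH AUDIT (c) `HOME/d2bridge/OBJECT-MATCH-AUDIT.md` §0–§3; item6-p3 g13 memo `X3-OMEGA-SIGN`): [Liu2021,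
App. D Step 1] builds `ω(ε)` on `V_ε = (Res_{E/F} V, Tr_{E/F} ε( , )_V)`; the tree's dual-pair lane at the hermitian line `⟨a⟩` (`a ∈ F⁺ˣ`)
carries the symplectic form `im_δ(a·h_V)` with `Tr_{F/F⁺}(δ_F z) = 2d · im_δ z`, `d = δ_F²` (`Automorphic/UnitaryGroupSymplecticEmbedding.lean`:
`trace_delta_mul`, `im_hermForm_map`, `toSymplectic`), i.e. the lane's form IS `Tr_{F/F⁺}((2δ_F)⁻¹·a·h_V)` = Liu's `V_ε` at `ε = (2δ_F)⁻¹·a`.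
ERRATUM riding along (audit §1 D4, §5 item 2): the convention paragraphs of `Literature/…/Liu2021/Def411WeilCarriers.lean` (module docstring,
bullet `epsOf e`) and of `CompatibleSplitting.lean` say «the form `Tr_{E/F}(δ·a·h_V)`»; the kernel objects carry `im_δ(a·h_V) =
Tr_{E/F}((2δ)⁻¹·a·h_V)` — same symplectic group, DIFFERENT index class — so Def. 4.12's «collection of `e ∈ E^{×−}`» is the local classes
of `e/δ′`, `δ′ = (2δ_F)⁻¹`: `Def411WeilCarriers.epsOf F⁺ (δ_F²) F δ′`.  At that token the label↔object dictionary is EXACT (audit §2 item 4);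
at the landed token `δ_F` (`Model.restOfCharD`, ✔ `Transposition/Item6RestOfChar.lean`) it is off by the class of `2d` (audit §3).  Nothing
landed is edited: this NEW SIBLING FILE instantiates item6-p3 g13's δ′-GENERIC `Model.restOfCharRep … δ′ r μ hμ hw`
(`Transposition/Item6RestOfCharRep.lean`) and `Model.admIndexAtLine ∕ omegaTransportAtLine …` (`Transposition/Item6OmegaTransportAtLine.lean`,
stated for any normaliser ANTI-ORIENTED to `δ_F`) at the ONE token `(2 * imagUnit F)⁻¹`, whose three normaliser obligations (`δ̄′ = −δ′`,
`δ′ ≠ 0`, `Im τ(δ′)·Im τ(δ_F) < 0`) are that file's theorems `OmegaTransport.complexConj_inv_two_mul_imagUnit ∕ inv_two_mul_imagUnit_ne_zero ∕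
antiOriented_inv_two_mul_imagUnit`.  The representative section `r : Rep F⁺ (δ_F²)` stays a binder: at the pinned dictionary
`r := Rep.update Rep.ofLineOf (locF u_a) u_a rfl` puts `ω(μ, ε_a, χ)` ON the package's line `diagonal (vec a)`, so `e` is `Submodule.quotEquivOfEq`.
NOT INSTANTIATED, deliberately: the other anti-oriented normaliser `δ̄_F = −δ_F` of the generic files' docstrings — anti-orientation makes
the labels admissible but `−δ_F` is off by the class of `2` (`(2, d)_v` obstruction; referee `HOME/d2bridge/OBJECT-MATCH-DELTAPRIME.md` §2.3:
EXACT at `(2δ_F)⁻¹` and at no other normaliser up to totally positive everywhere-local-norm factors).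
Seat prover-pub-hodgecm2-d2bridge-prove-4-g1-0 (Δ2 bridge prove-4 gen 1; PEN of the top row, SECOND d2bridge-prove-1 g1, CONSULTANT
own-htheta g10).  Abbreviations + theorems only; no named fact, no instance, no `variable`; the package modules are IMPORTED, never restated.
HC_CM is NOT proved; «Δ2 BRIDGE CLOSED» is NOT claimed; `h21`, `hD1` are hypotheses of two theorems; hLiu = «[Liu21] Thm 4.18 at the
constructed objects AS A READING (r8 stronger-in-X; Δ2 bridge OPEN)» until the pins land and the referee signs; no pointer moves.
-/
import Summits.HodgeConjecture.CorCM.B01.Transposition.Item6RestOfCharRep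
import Summits.HodgeConjecture.CorCM.B01.Transposition.Item6OmegaTransportCenter
import Summits.HodgeConjecture.HodgeCM.Model.WeilCentralCoinvariants_2
import HarnessLib

set_option autoImplicit false

/-!
# `Model.restOfCharDeltaPrime … r μ hμ hw` — the Liu rest at `δ′ = (2δ_F)⁻¹`, and R1 there

* §1 `Model.restOfCharDeltaPrime h F h6 ι₁ V Φ e dV hdV hdV0 ιV r μ hμ hw := restOfCharRep … (2 * imagUnit F)⁻¹ r μ hμ hw`
  with the Liu-side readings `nonempty_obj_restOfCharDeltaPrime (h21)`, `rhoAt_restOfCharDeltaPrime_smooth (hιc)`, `rhoAt_restOfCharDeltaPrime_isIrreducible_of_lemD1AsPrinted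
  (hιs) (hn) (i) (hD1)`, `nontrivial_omegaAt_restOfCharDeltaPrime_of_lemD1AsPrinted` (the Δ2 junction's `hnvD` pin from `hD1`);
* §2 R1 AT δ′ (self-contained): `Model.admIndexAtDeltaPrime` (= `σ`), `admIndexAtDeltaPrime_fst`, `admIndexAtDeltaPrime_injective` (= `hσ`), `Model.omegaTransportAtDeltaPrime` (= `e`), `omegaTransportAtDeltaPrime_mk`, `omegaTransportAtDeltaPrime_smul` (= `he`).

HC_CM is NOT proved.
-/

noncomputable section

open scoped TensorProduct Matrix

namespace Summit.HodgeConjecture.CorCM.Model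

open CategoryTheory CategoryTheory.Limits AlgebraicGeometry NumberField IsDedekindDomain
open Literature.AlgebraicGeometry.Motives
open Literature.AlgebraicGeometry.HodgeTheory
open Literature.AlgebraicGeometry.ShimuraVarieties
open Literature.AlgebraicGeometry.ShimuraVarieties.UnitaryCanonicalModel
open Literature.AlgebraicGeometry.Liu2021 (IsAdmissibleElement)
open Literature.NumberTheory.ComplexMultiplication
open Literature.NumberTheory.Automorphic
open Literature.NumberTheory.Automorphic.IdeleClassGroup
open Literature.NumberTheory.Automorphic.PicardCM
open Literature.NumberTheory.Automorphic.Liu2021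
open Literature.NumberTheory.Automorphic.Liu2021.AppendixC
open Literature.NumberTheory.Automorphic.Liu2021.AppendixC.RestOne
open Literature.NumberTheory.Automorphic.Liu2021.Def411WeilCarriers (JW TW isSymm_TW isUnit_det_TW JW_eq JW_apply_ne_zero locF lineOf Rep
  Eps Chi epsOf omegaAtLine rhoAtLine rhoVAtLine lineChar)
open Literature.NumberTheory.GelbartRogawski1991 Literature.NumberTheory.GelbartRogawski1991.UnitaryDualPair
open Literature.NumberTheory.GelbartRogawski1991.UnitaryDualPair.LocalSplitting (localMu norm_localMu continuous_localMu localMu_toLocalRing_eq_one_iff)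
open Literature.NumberTheory.Weil1964 Literature.RepresentationTheory
open Literature.RepresentationTheory.Liu2021
open Summit.HodgeConjecture.CorCM.Transposition
open Summit.HodgeConjecture.CorCM.Transposition.OmegaTransport

/-! ## §1 The rest at `δ′ = (2δ_F)⁻¹` and its readings -/

section Rest

/-- **The Liu rest at the ε-normaliser of record `δ′ := (2δ_F)⁻¹`** ([Liu2021] Def. 4.5 (2) ∕ 4.11 ∕ 4.12 ∕ 4.16 carriers over the
constructed §4.2 datum `sec42DataOf h isoOf F ι₁ V Φ`): item6-p3's `restOfCharRep` with Def. 4.12's «collection of `e ∈ E^{×−}`» read as the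
local classes of `e/δ′ = 2δ_F·e` (`epsOf … (2 * imagUnit F)⁻¹`), so that the oscillator carried at the label `ε` — the Weil `χ`-coinvariants
on the line `⟨r ε⟩`, symplectic form `im_δ((r ε)·h_V) = Tr_{F/F⁺}((2δ_F)⁻¹ (r ε) h_V)` — IS Liu's `ω(μ, ε, χ)` of App. D Step 1–3 at
`V_ε = (Res V, Tr ε( , )_V)` (referee OBJECT-MATCH AUDIT §2).  The representative section `r` is a parameter (the pin re-points it to
the package's line).
[cite: Liu2021, Def. 4.5 (2) (FJcycle.tex l. 1944–1958), Def. 4.11 (l. 2088–2096), Def. 4.12 (l. 2102–2108), Def. 4.16 (l. 2219), App. D §D.1 Steps 1–3 (l. 5215–5221)]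
[cite: GelbartRogawski1991, §3.1 Prop. 3.1.1 p. 455 L1–3] -/
abbrev restOfCharDeltaPrime (h : exists_recordSystem) (F : CMField) [IsGalois ℚ F] (h6 : 6 ≤ Module.finrank ℚ F)
    (ι₁ : F →+* ℂ) (V : HermSpace3 F ι₁) (Φ : CMType F) {n : ℕ} (e : Fin 3 × Fin 1 ≃ Fin n) (dV : Fin 3 → F)
    (hdV : ∀ i, IsCMField.complexConj F (dV i) = dV i) (hdV0 : ∀ i, dV i ≠ 0)
    (ιV : (sec42DataOf h isoOf F ι₁ V Φ).G →*
      UnitaryGroup.finAdelic ↥(maximalRealSubfield F) F (IsCMField.complexConj F) 3 (Matrix.diagonal dV))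
    (r : Rep ↥(maximalRealSubfield F) (imagUnitSq F))
    (μ : IdeleClassGroup F →ₜ* Circle) (hμ : IdeleClassGroup.IsConjugateSymplectic F μ) (hw : IdeleClassGroup.HasWeight F μ 1) :
    Thm418Rest (sec42DataOf h isoOf F ι₁ V Φ) :=
  restOfCharRep h F h6 ι₁ V Φ e dV hdV hdV0 ιV (2 * imagUnit F)⁻¹ r μ hμ hw

/-- **`𝒜(μ) ≠ ∅`** at the δ′ rest, from `h21` ([Shimura1998] Thm. 21.4 via `Def45.nonempty_cmDatum_polDR_rMuForm_of_casselman`).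
[cite: Liu2021, Prop. 4.6 (1) (FJcycle.tex l. 1969)] [cite: Shimura1998, §21.4 Thm. 21.4] -/
theorem nonempty_obj_restOfCharDeltaPrime (h : exists_recordSystem) (F : CMField) [IsGalois ℚ F] (h6 : 6 ≤ Module.finrank ℚ F)
    (ι₁ : F →+* ℂ) (V : HermSpace3 F ι₁) (Φ : CMType F) {n : ℕ} (e : Fin 3 × Fin 1 ≃ Fin n) (dV : Fin 3 → F)
    (hdV : ∀ i, IsCMField.complexConj F (dV i) = dV i) (hdV0 : ∀ i, dV i ≠ 0)
    (ιV : (sec42DataOf h isoOf F ι₁ V Φ).G →*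
      UnitaryGroup.finAdelic ↥(maximalRealSubfield F) F (IsCMField.complexConj F) 3 (Matrix.diagonal dV))
    (r : Rep ↥(maximalRealSubfield F) (imagUnitSq F))
    (μ : IdeleClassGroup F →ₜ* Circle) (hμ : IdeleClassGroup.IsConjugateSymplectic F μ) (hw : IdeleClassGroup.HasWeight F μ 1)
    (h21 : shimura1998_thm21_4_casselman) :
    Nonempty (toThm418Data (sec42DataOf h isoOf F ι₁ V Φ) (restOfCharDeltaPrime h F h6 ι₁ V Φ e dV hdV hdV0 ιV r μ hμ hw)).Obj :=
  nonempty_obj_restOfCharRep h F h6 ι₁ V Φ e dV hdV hdV0 ιV _ r μ hμ hw h21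

/-- **smoothness** at the δ′ rest (`ιV` continuous). [cite: Liu2021, Def. 4.11 (FJcycle.tex l. 2094–2096)] -/
theorem rhoAt_restOfCharDeltaPrime_smooth (h : exists_recordSystem) (F : CMField) [IsGalois ℚ F] (h6 : 6 ≤ Module.finrank ℚ F)
    (ι₁ : F →+* ℂ) (V : HermSpace3 F ι₁) (Φ : CMType F) {n : ℕ} (e : Fin 3 × Fin 1 ≃ Fin n) (dV : Fin 3 → F)
    (hdV : ∀ i, IsCMField.complexConj F (dV i) = dV i) (hdV0 : ∀ i, dV i ≠ 0)
    (ιV : (sec42DataOf h isoOf F ι₁ V Φ).G →*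
      UnitaryGroup.finAdelic ↥(maximalRealSubfield F) F (IsCMField.complexConj F) 3 (Matrix.diagonal dV))
    (r : Rep ↥(maximalRealSubfield F) (imagUnitSq F))
    (μ : IdeleClassGroup F →ₜ* Circle) (hμ : IdeleClassGroup.IsConjugateSymplectic F μ) (hw : IdeleClassGroup.HasWeight F μ 1) (hιc : Continuous ιV)
    (i : (toThm418Data (sec42DataOf h isoOf F ι₁ V Φ) (restOfCharDeltaPrime h F h6 ι₁ V Φ e dV hdV hdV0 ιV r μ hμ hw)).AdmIndex)
    (v : (toThm418Data (sec42DataOf h isoOf F ι₁ V Φ) (restOfCharDeltaPrime h F h6 ι₁ V Φ e dV hdV hdV0 ιV r μ hμ hw)).omegaAt i) :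
    ∃ S : Subgroup (sec42DataOf h isoOf F ι₁ V Φ).G, IsOpen (S : Set (sec42DataOf h isoOf F ι₁ V Φ).G) ∧
      ∀ k ∈ S, (toThm418Data (sec42DataOf h isoOf F ι₁ V Φ) (restOfCharDeltaPrime h F h6 ι₁ V Φ e dV hdV hdV0 ιV r μ hμ hw)).rhoAt i k v = v :=
  rhoAt_restOfCharRep_smooth h F h6 ι₁ V Φ e dV hdV hdV0 ιV _ r μ hμ hw hιc i v

/-- **irreducibility** at the δ′ rest, from [Liu2021, App. D Lemma D.1 (1)] AS PRINTED per place at the `μ`-attached local data on the line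
`⟨r ε⟩` (hypothesis `hD1`), `ιV` onto, `3 ≤ n`. [cite: Liu2021, Def. 4.11 (FJcycle.tex l. 2090–2096), App. D Lemma D.1 (l. 5227; (1) l. 5229)]
[cite: GelbartRogawski1991, §3.1 Prop. 3.1.1 p. 455 L1–3, Remark p. 457 L4–13] -/
theorem rhoAt_restOfCharDeltaPrime_isIrreducible_of_lemD1AsPrinted (h : exists_recordSystem) (F : CMField) [IsGalois ℚ F]
    (h6 : 6 ≤ Module.finrank ℚ F)
    (ι₁ : F →+* ℂ) (V : HermSpace3 F ι₁) (Φ : CMType F) {n : ℕ} (e : Fin 3 × Fin 1 ≃ Fin n) (dV : Fin 3 → F)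
    (hdV : ∀ i, IsCMField.complexConj F (dV i) = dV i) (hdV0 : ∀ i, dV i ≠ 0)
    (ιV : (sec42DataOf h isoOf F ι₁ V Φ).G →*
      UnitaryGroup.finAdelic ↥(maximalRealSubfield F) F (IsCMField.complexConj F) 3 (Matrix.diagonal dV))
    (r : Rep ↥(maximalRealSubfield F) (imagUnitSq F))
    (μ : IdeleClassGroup F →ₜ* Circle) (hμ : IdeleClassGroup.IsConjugateSymplectic F μ) (hw : IdeleClassGroup.HasWeight F μ 1)
    (hιs : Function.Surjective ιV) (hn : 3 ≤ n)
    (i : (toThm418Data (sec42DataOf h isoOf F ι₁ V Φ) (restOfCharDeltaPrime h F h6 ι₁ V Φ e dV hdV hdV0 ιV r μ hμ hw)).AdmIndex)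
    (hD1 : ∀ v : HeightOneSpectrum (𝓞 ↥(maximalRealSubfield F)), LemD1_1AsPrinted
      (Def411WeilCarriers.localLemD1Data ↥(maximalRealSubfield F) F (IsCMField.complexConj F) 3 e (Matrix.diagonal dV)
        (complexConj_imagUnit F) (imagUnit_ne_zero F) (imagUnit_mul_self F) (realDiagonal_isSymm F dV hdV)
        (isUnit_det_realDiagonal F dV hdV hdV0) (realDiagonal_map F dV hdV).symm (r.toFun i.1.1)
        (OmegaChiSplitting.chiLocalSplittingsD F e dV hdV hdV0 (toHeckeCharacter F μ) ((isOscillatorChar_toHeckeCharacter_iff μ).mpr hμ)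
          (r.toFun i.1.1))
        hn (localMu F (toHeckeCharacter F μ))
        (fun v x => norm_localMu F (toHeckeCharacter F μ) v (isUnitary_toHeckeCharacter F μ) x)
        (continuous_localMu F (toHeckeCharacter F μ))
        (fun v t => localMu_toLocalRing_eq_one_iff F (toHeckeCharacter F μ) v ((isOscillatorChar_toHeckeCharacter_iff μ).mpr hμ) t)
        i.1.2.1
        (Def411WeilCarriers.norm_chi_eq_one ↥(maximalRealSubfield F) F (IsCMField.complexConj F)
          (Algebra.IsQuadraticExtension.finrank_eq_two ↥(maximalRealSubfield F) F)
          (UnitaryGroup.algEquiv_ne_one_of_apply_eq_neg ↥(maximalRealSubfield F) F (IsCMField.complexConj F) (complexConj_imagUnit F)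
            (imagUnit_ne_zero F)) i.1.2)
        i.1.2.2.1 v)) :
    ((toThm418Data (sec42DataOf h isoOf F ι₁ V Φ) (restOfCharDeltaPrime h F h6 ι₁ V Φ e dV hdV hdV0 ιV r μ hμ hw)).rhoAt i).IsIrreducible :=
  rhoAt_restOfCharRep_isIrreducible_of_lemD1AsPrinted h F h6 ι₁ V Φ e dV hdV hdV0 ιV _ r μ hμ hw hιs hn i hD1

/-- **`ω(μ, ε, χ) ≠ 0`** at the δ′ rest — the Δ2 junction's `hnvD` pin, from `hD1` (`Representation.IsIrreducible.nontrivial`).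
[cite: Liu2021, Def. 4.11 (FJcycle.tex l. 2094–2096), App. D Lemma D.1 (1) (l. 5229)] -/
theorem nontrivial_omegaAt_restOfCharDeltaPrime_of_lemD1AsPrinted (h : exists_recordSystem) (F : CMField) [IsGalois ℚ F]
    (h6 : 6 ≤ Module.finrank ℚ F)
    (ι₁ : F →+* ℂ) (V : HermSpace3 F ι₁) (Φ : CMType F) {n : ℕ} (e : Fin 3 × Fin 1 ≃ Fin n) (dV : Fin 3 → F)
    (hdV : ∀ i, IsCMField.complexConj F (dV i) = dV i) (hdV0 : ∀ i, dV i ≠ 0)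
    (ιV : (sec42DataOf h isoOf F ι₁ V Φ).G →*
      UnitaryGroup.finAdelic ↥(maximalRealSubfield F) F (IsCMField.complexConj F) 3 (Matrix.diagonal dV))
    (r : Rep ↥(maximalRealSubfield F) (imagUnitSq F))
    (μ : IdeleClassGroup F →ₜ* Circle) (hμ : IdeleClassGroup.IsConjugateSymplectic F μ) (hw : IdeleClassGroup.HasWeight F μ 1)
    (hιs : Function.Surjective ιV) (hn : 3 ≤ n)
    (i : (toThm418Data (sec42DataOf h isoOf F ι₁ V Φ) (restOfCharDeltaPrime h F h6 ι₁ V Φ e dV hdV hdV0 ιV r μ hμ hw)).AdmIndex)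
    (hD1 : ∀ v : HeightOneSpectrum (𝓞 ↥(maximalRealSubfield F)), LemD1_1AsPrinted
      (Def411WeilCarriers.localLemD1Data ↥(maximalRealSubfield F) F (IsCMField.complexConj F) 3 e (Matrix.diagonal dV)
        (complexConj_imagUnit F) (imagUnit_ne_zero F) (imagUnit_mul_self F) (realDiagonal_isSymm F dV hdV)
        (isUnit_det_realDiagonal F dV hdV hdV0) (realDiagonal_map F dV hdV).symm (r.toFun i.1.1)
        (OmegaChiSplitting.chiLocalSplittingsD F e dV hdV hdV0 (toHeckeCharacter F μ) ((isOscillatorChar_toHeckeCharacter_iff μ).mpr hμ)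
          (r.toFun i.1.1))
        hn (localMu F (toHeckeCharacter F μ))
        (fun v x => norm_localMu F (toHeckeCharacter F μ) v (isUnitary_toHeckeCharacter F μ) x)
        (continuous_localMu F (toHeckeCharacter F μ))
        (fun v t => localMu_toLocalRing_eq_one_iff F (toHeckeCharacter F μ) v ((isOscillatorChar_toHeckeCharacter_iff μ).mpr hμ) t)
        i.1.2.1
        (Def411WeilCarriers.norm_chi_eq_one ↥(maximalRealSubfield F) F (IsCMField.complexConj F)
          (Algebra.IsQuadraticExtension.finrank_eq_two ↥(maximalRealSubfield F) F)
          (UnitaryGroup.algEquiv_ne_one_of_apply_eq_neg ↥(maximalRealSubfield F) F (IsCMField.complexConj F) (complexConj_imagUnit F)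
            (imagUnit_ne_zero F)) i.1.2)
        i.1.2.2.1 v)) :
    Nontrivial ((toThm418Data (sec42DataOf h isoOf F ι₁ V Φ) (restOfCharDeltaPrime h F h6 ι₁ V Φ e dV hdV hdV0 ιV r μ hμ hw)).omegaAt i) :=
  nontrivial_omegaAt_restOfCharRep_of_lemD1AsPrinted h F h6 ι₁ V Φ e dV hdV hdV0 ιV _ r μ hμ hw hιs hn i hD1

end Rest
/-! ## §2 R1 at δ′: `σ ∕ hσ ∕ e ∕ he`, normaliser obligations discharged (self-contained: item6-p3 g13's §3–§4 of
`Item6OmegaTransportAtLine.v1` d300c6f73c1e with `δ' := (2 * imagUnit F)⁻¹` and its three witnesses substituted, nothing else changed) -/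

section Sigma

set_option maxHeartbeats 1000000 in
/-- **`σ` — THE ADMISSIBLE INDEX `(ε, χ ∘ centre)` OF [Liu2021, Thm. 4.18]'s DIRECT SUM at the Liu datum `restOfCharDeltaPrime … r μ hμ hw`**, for a
collection `ε` represented by `r` (`locF (r ε) = ε`, i.e. `ε` global), a character `χ` of `U(J_W′)(𝔸_f)`, `J_W′ = (r ε)`, with open kernel and
trivial rational restriction, at THE normaliser of record `δ′ = (2δ_F)⁻¹` (anti-oriented to `δ_F`: `antiOriented_inv_two_mul_imagUnit`) and `Φ_μ`
δ-positive at `r ε` (the line of record's `Φ^δ`): Def. 4.12's witness is `e₀ := (r ε)·(2δ_F)⁻¹` (`isAdmissibleElement_mul_of_antiOriented`,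
`epsOf_algebraMap_mul`, `r.locF_toFun`) — so THE LABEL OF `σ χ` IS LIU'S OWN `ε` (no re-keying).
[cite: Liu2021, Def. 4.11 (FJcycle.tex l. 2088–2090), Def. 4.12 (l. 2102–2108), Thm. 4.18 (l. 2232–2237)] -/
def admIndexAtDeltaPrime (h : exists_recordSystem) (F : CMField) [IsGalois ℚ F] (h6 : 6 ≤ Module.finrank ℚ F)
    (ι₁ : F →+* ℂ) (V : HermSpace3 F ι₁) (Φ : CMType F) {n : ℕ} (e : Fin 3 × Fin 1 ≃ Fin n) (dV : Fin 3 → F)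
    (hdV : ∀ i, IsCMField.complexConj F (dV i) = dV i) (hdV0 : ∀ i, dV i ≠ 0)
    (ιV : (sec42DataOf h isoOf F ι₁ V Φ).G →*
      UnitaryGroup.finAdelic ↥(maximalRealSubfield F) F (IsCMField.complexConj F) 3 (Matrix.diagonal dV))
    (r : Rep ↥(maximalRealSubfield F) (imagUnitSq F))
    (μ : IdeleClassGroup F →ₜ* Circle) (hμ : IdeleClassGroup.IsConjugateSymplectic F μ) (hw : IdeleClassGroup.HasWeight F μ 1)
    (ε : Eps ↥(maximalRealSubfield F) (imagUnitSq F)) (hε : ∃ a, locF ↥(maximalRealSubfield F) (imagUnitSq F) a = ε)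
    (hΦ : ∀ τ : F →+* ℂ, τ ∈ hμ.cmType.1 → 0 < (τ (imagUnit F * algebraMap ↥(maximalRealSubfield F) F (r.toFun ε))).im)
    (JW' : Matrix (Fin 1) (Fin 1) F) (hJ : JW ↥(maximalRealSubfield F) F (r.toFun ε) = JW')
    (χ : {χ : ↥(UnitaryGroup.finAdelic ↥(maximalRealSubfield F) F (IsCMField.complexConj F) 1 JW') →* ℂˣ //
      IsOpen ((χ.ker : Subgroup _) : Set ↥(UnitaryGroup.finAdelic ↥(maximalRealSubfield F) F (IsCMField.complexConj F) 1 JW')) ∧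
        ∀ γ : UnitaryGroup.rational ↥(maximalRealSubfield F) F (IsCMField.complexConj F) 1 JW',
          χ (UnitaryGroup.rationalToFinAdelic ↥(maximalRealSubfield F) F (IsCMField.complexConj F) 1 JW' γ) = 1}) :
    (toThm418Data (sec42DataOf h isoOf F ι₁ V Φ) (restOfCharDeltaPrime h F h6 ι₁ V Φ e dV hdV hdV0 ιV r μ hμ hw)).AdmIndex :=
  ⟨(ε, chiAtLine F (r.toFun ε) JW' hJ χ.1 χ.2.1 χ.2.2),
    ⟨algebraMap ↥(maximalRealSubfield F) F (r.toFun ε) * (2 * imagUnit F)⁻¹,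
      isAdmissibleElement_mul_of_antiOriented F _ (r.toFun ε) _ (complexConj_inv_two_mul_imagUnit F)
        (inv_two_mul_imagUnit_ne_zero F) (antiOriented_inv_two_mul_imagUnit F) hΦ,
      (Def411WeilCarriers.epsOf_algebraMap_mul ↥(maximalRealSubfield F) (imagUnitSq F) F _ (inv_two_mul_imagUnit_ne_zero F)
        (r.toFun ε)).trans (r.locF_toFun ε hε)⟩⟩

/-- the `Eps`-component of `σ χ` is `ε`. [cite: Liu2021, Thm. 4.18 (FJcycle.tex l. 2232–2237)] -/
theorem admIndexAtDeltaPrime_fst (h : exists_recordSystem) (F : CMField) [IsGalois ℚ F] (h6 : 6 ≤ Module.finrank ℚ F)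
    (ι₁ : F →+* ℂ) (V : HermSpace3 F ι₁) (Φ : CMType F) {n : ℕ} (e : Fin 3 × Fin 1 ≃ Fin n) (dV : Fin 3 → F)
    (hdV : ∀ i, IsCMField.complexConj F (dV i) = dV i) (hdV0 : ∀ i, dV i ≠ 0)
    (ιV : (sec42DataOf h isoOf F ι₁ V Φ).G →*
      UnitaryGroup.finAdelic ↥(maximalRealSubfield F) F (IsCMField.complexConj F) 3 (Matrix.diagonal dV))
    (r : Rep ↥(maximalRealSubfield F) (imagUnitSq F))
    (μ : IdeleClassGroup F →ₜ* Circle) (hμ : IdeleClassGroup.IsConjugateSymplectic F μ) (hw : IdeleClassGroup.HasWeight F μ 1)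
    (ε : Eps ↥(maximalRealSubfield F) (imagUnitSq F)) (hε : ∃ a, locF ↥(maximalRealSubfield F) (imagUnitSq F) a = ε)
    (hΦ : ∀ τ : F →+* ℂ, τ ∈ hμ.cmType.1 → 0 < (τ (imagUnit F * algebraMap ↥(maximalRealSubfield F) F (r.toFun ε))).im)
    (JW' : Matrix (Fin 1) (Fin 1) F) (hJ : JW ↥(maximalRealSubfield F) F (r.toFun ε) = JW')
    (χ : {χ : ↥(UnitaryGroup.finAdelic ↥(maximalRealSubfield F) F (IsCMField.complexConj F) 1 JW') →* ℂˣ //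
      IsOpen ((χ.ker : Subgroup _) : Set ↥(UnitaryGroup.finAdelic ↥(maximalRealSubfield F) F (IsCMField.complexConj F) 1 JW')) ∧
        ∀ γ : UnitaryGroup.rational ↥(maximalRealSubfield F) F (IsCMField.complexConj F) 1 JW',
          χ (UnitaryGroup.rationalToFinAdelic ↥(maximalRealSubfield F) F (IsCMField.complexConj F) 1 JW' γ) = 1}) :
    (admIndexAtDeltaPrime h F h6 ι₁ V Φ e dV hdV hdV0 ιV r μ hμ hw ε hε hΦ JW' hJ χ).1.1 = ε :=
  rfl

/-- **`hσ` — `σ` is injective in `χ`.** [cite: Liu2021, Thm. 4.18 (FJcycle.tex l. 2232–2237)] -/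
theorem admIndexAtDeltaPrime_injective (h : exists_recordSystem) (F : CMField) [IsGalois ℚ F] (h6 : 6 ≤ Module.finrank ℚ F)
    (ι₁ : F →+* ℂ) (V : HermSpace3 F ι₁) (Φ : CMType F) {n : ℕ} (e : Fin 3 × Fin 1 ≃ Fin n) (dV : Fin 3 → F)
    (hdV : ∀ i, IsCMField.complexConj F (dV i) = dV i) (hdV0 : ∀ i, dV i ≠ 0)
    (ιV : (sec42DataOf h isoOf F ι₁ V Φ).G →*
      UnitaryGroup.finAdelic ↥(maximalRealSubfield F) F (IsCMField.complexConj F) 3 (Matrix.diagonal dV))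
    (r : Rep ↥(maximalRealSubfield F) (imagUnitSq F))
    (μ : IdeleClassGroup F →ₜ* Circle) (hμ : IdeleClassGroup.IsConjugateSymplectic F μ) (hw : IdeleClassGroup.HasWeight F μ 1)
    (ε : Eps ↥(maximalRealSubfield F) (imagUnitSq F)) (hε : ∃ a, locF ↥(maximalRealSubfield F) (imagUnitSq F) a = ε)
    (hΦ : ∀ τ : F →+* ℂ, τ ∈ hμ.cmType.1 → 0 < (τ (imagUnit F * algebraMap ↥(maximalRealSubfield F) F (r.toFun ε))).im)
    (JW' : Matrix (Fin 1) (Fin 1) F) (hJ : JW ↥(maximalRealSubfield F) F (r.toFun ε) = JW') :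
    Function.Injective (admIndexAtDeltaPrime h F h6 ι₁ V Φ e dV hdV hdV0 ιV r μ hμ hw ε hε hΦ JW' hJ) := by
  intro χ₁ χ₂ hχ
  have h2 : chiAtLine F (r.toFun ε) JW' hJ χ₁.1 χ₁.2.1 χ₁.2.2 = chiAtLine F (r.toFun ε) JW' hJ χ₂.1 χ₂.2.1 χ₂.2.2 :=
    (Prod.ext_iff.1 (congrArg Subtype.val hχ)).2
  exact Subtype.ext (chiAtLine_injective F (r.toFun ε) JW' hJ χ₁.2.1 χ₁.2.2 χ₂.2.1 χ₂.2.2 h2)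

end Sigma
section TransportHelpers

/-- the port's and the Literature's relation submodules of the `χ`-coinvariants are THE SAME submodule (twin definitions), for equal
characters. [folklore] -/
private theorem ker_twin_eq {k : Type*} [CommRing k] {H S : Type*} [Group H] [AddCommGroup S] [Module k S]
    (ρW : Representation k H S) {χ ψ : H →* kˣ} (hψ : ψ = χ) :
    HodgeCM.TwistedCoinv.ker ρW χ = Literature.RepresentationTheory.TwistedCoinv.ker ρW ψ := by
  subst hψ
  rfl

/-- on `ρ.asModule` the group-ring generator `of g` acts by `ρ g` (`Representation.asModuleEquiv_symm_map_rho`, the identification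
`asModuleEquiv` being the identity). [folklore] -/
private theorem of_smul_eq_asModule {k G W : Type*} [CommSemiring k] [Monoid G] [AddCommMonoid W] [Module k W]
    (ρ : Representation k G W) (g : G) (x : ρ.asModule) :
    MonoidAlgebra.of k G g • x = ρ.asModuleEquiv.symm (ρ g (ρ.asModuleEquiv x)) := by
  rw [Representation.asModuleEquiv_symm_map_rho, LinearEquiv.symm_apply_apply]

end TransportHelpers
section Transport

set_option maxHeartbeats 2000000 in
-- (the two `subst`s and the definitional comparison of the twin `finPairRepW`s run over the `splittingDatum` telescope)
/-- **`e` — THE X3-ω TRANSPORT at the line of record**: the package's Weil `χ`-coinvariant module of the finite-adelic dual pair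
`U(diag dV) × U(J_W′)` at the splitting `ι_{toHecke μ}` transported to `(T_W′, J_W′)` (`chiSplittingLine …`, [GR91] Prop. 3.1.1 ∕ [Liu2021] App. D
Step 2), pulled back along `ιV` — LITERALLY the carrier `Representation.asModule ((HodgeCM.WeilCoinv.weilCoinv …).comp ιV)` of
`SplitLine.Ω (ofCM …) ιV χ` — IS, as a `ℂ`-module, `ω(μ, ε, χ ∘ centre) = (toThm418Data … (restOfCharRep … δ′ r μ hμ hw)).omegaAt (σ χ)` whenever
`(T_W′, J_W′) = (T_W (r ε), J_W (r ε))`: both are quotients of `𝒮((𝔸_{F⁺}^∞)^{3·1})` by THE SAME relation submodule (`Submodule.quotEquivOfEq`; the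
port's and the Literature's `finPairRepW ∕ TwistedCoinv.ker` agree by `rfl`, the characters by `lineChar_chiAtLine_self`).
[cite: Liu2021, Def. 4.11 (FJcycle.tex l. 2092–2096), App. D §D.1 Steps 1–3 (l. 5215–5221), Thm. 4.18 (l. 2232–2237)]
[cite: GelbartRogawski1991, §3.1 Prop. 3.1.1 p. 455 L1–3] -/
def omegaTransportAtDeltaPrime (h : exists_recordSystem) (F : CMField) [IsGalois ℚ F] (h6 : 6 ≤ Module.finrank ℚ F)
    (ι₁ : F →+* ℂ) (V : HermSpace3 F ι₁) (Φ : CMType F) {n : ℕ} (e : Fin 3 × Fin 1 ≃ Fin n) (dV : Fin 3 → F)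
    (hdV : ∀ i, IsCMField.complexConj F (dV i) = dV i) (hdV0 : ∀ i, dV i ≠ 0)
    (ιV : (sec42DataOf h isoOf F ι₁ V Φ).G →*
      UnitaryGroup.finAdelic ↥(maximalRealSubfield F) F (IsCMField.complexConj F) 3 (Matrix.diagonal dV))
    (r : Rep ↥(maximalRealSubfield F) (imagUnitSq F))
    (μ : IdeleClassGroup F →ₜ* Circle) (hμ : IdeleClassGroup.IsConjugateSymplectic F μ) (hw : IdeleClassGroup.HasWeight F μ 1)
    (ε : Eps ↥(maximalRealSubfield F) (imagUnitSq F)) (hε : ∃ a, locF ↥(maximalRealSubfield F) (imagUnitSq F) a = ε)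
    (hΦ : ∀ τ : F →+* ℂ, τ ∈ hμ.cmType.1 → 0 < (τ (imagUnit F * algebraMap ↥(maximalRealSubfield F) F (r.toFun ε))).im)
    (TW' : Matrix (Fin 1) (Fin 1) ↥(maximalRealSubfield F)) (JW' : Matrix (Fin 1) (Fin 1) F)
    (hW' : TW'.IsSymm) (hWd' : IsUnit TW'.det) (hJW' : JW' = TW'.map (algebraMap ↥(maximalRealSubfield F) F))
    (hT : TW ↥(maximalRealSubfield F) (r.toFun ε) = TW') (hJ : JW ↥(maximalRealSubfield F) F (r.toFun ε) = JW')
    (hs' : (splittingDatum ↥(maximalRealSubfield F) F (IsCMField.complexConj F) 3 1 e (Matrix.diagonal dV) JW'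
        (complexConj_imagUnit F) (imagUnit_ne_zero F) (imagUnit_mul_self F) (realDiagonal_isSymm F dV hdV) hW'
        (isUnit_det_realDiagonal F dV hdV hdV0) hWd' (realDiagonal_map F dV hdV).symm hJW').IsCompatible
      (Def411WeilCarriersDoubling.chiSplittingLine F e dV hdV hdV0 (toHeckeCharacter F μ) (isUnitary_toHeckeCharacter F μ)
        ((isOscillatorChar_toHeckeCharacter_iff μ).mpr hμ) TW' hWd' JW' hJW'))
    (χ : {χ : ↥(UnitaryGroup.finAdelic ↥(maximalRealSubfield F) F (IsCMField.complexConj F) 1 JW') →* ℂˣ //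
      IsOpen ((χ.ker : Subgroup _) : Set ↥(UnitaryGroup.finAdelic ↥(maximalRealSubfield F) F (IsCMField.complexConj F) 1 JW')) ∧
        ∀ γ : UnitaryGroup.rational ↥(maximalRealSubfield F) F (IsCMField.complexConj F) 1 JW',
          χ (UnitaryGroup.rationalToFinAdelic ↥(maximalRealSubfield F) F (IsCMField.complexConj F) 1 JW' γ) = 1}) :
    Representation.asModule
        ((HodgeCM.WeilCoinv.weilCoinv ↥(maximalRealSubfield F) F (IsCMField.complexConj F) 3 1 e (Matrix.diagonal dV) JW'
          (complexConj_imagUnit F) (imagUnit_ne_zero F) (imagUnit_mul_self F) (realDiagonal_isSymm F dV hdV) hW'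
          (isUnit_det_realDiagonal F dV hdV hdV0) hWd' (realDiagonal_map F dV hdV).symm hJW' χ.1 hs').comp ιV) ≃ₗ[ℂ]
      (toThm418Data (sec42DataOf h isoOf F ι₁ V Φ) (restOfCharDeltaPrime h F h6 ι₁ V Φ e dV hdV hdV0 ιV r μ hμ hw)).omegaAt
        (admIndexAtDeltaPrime h F h6 ι₁ V Φ e dV hdV hdV0 ιV r μ hμ hw ε hε hΦ JW' hJ χ) := by
  subst hJ
  subst hT
  refine Submodule.quotEquivOfEq _ _ ?_
  -- the two relation submodules of `𝒮((𝔸^∞)^{3·1})`: same finite Weil representation (twin constructions, `rfl`), same character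
  exact ker_twin_eq _ (lineChar_chiAtLine_self F (r.toFun ε) χ.1 χ.2.1 χ.2.2)

set_option maxHeartbeats 2000000 in
/-- `e` on generators: the class of `f ∈ 𝒮` goes to the class of `f`. [cite: Liu2021, App. D §D.1 Step 3 (FJcycle.tex l. 5221)] -/
theorem omegaTransportAtDeltaPrime_mk (h : exists_recordSystem) (F : CMField) [IsGalois ℚ F] (h6 : 6 ≤ Module.finrank ℚ F)
    (ι₁ : F →+* ℂ) (V : HermSpace3 F ι₁) (Φ : CMType F) {n : ℕ} (e : Fin 3 × Fin 1 ≃ Fin n) (dV : Fin 3 → F)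
    (hdV : ∀ i, IsCMField.complexConj F (dV i) = dV i) (hdV0 : ∀ i, dV i ≠ 0)
    (ιV : (sec42DataOf h isoOf F ι₁ V Φ).G →*
      UnitaryGroup.finAdelic ↥(maximalRealSubfield F) F (IsCMField.complexConj F) 3 (Matrix.diagonal dV))
    (r : Rep ↥(maximalRealSubfield F) (imagUnitSq F))
    (μ : IdeleClassGroup F →ₜ* Circle) (hμ : IdeleClassGroup.IsConjugateSymplectic F μ) (hw : IdeleClassGroup.HasWeight F μ 1)
    (ε : Eps ↥(maximalRealSubfield F) (imagUnitSq F)) (hε : ∃ a, locF ↥(maximalRealSubfield F) (imagUnitSq F) a = ε)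
    (hΦ : ∀ τ : F →+* ℂ, τ ∈ hμ.cmType.1 → 0 < (τ (imagUnit F * algebraMap ↥(maximalRealSubfield F) F (r.toFun ε))).im)
    (TW' : Matrix (Fin 1) (Fin 1) ↥(maximalRealSubfield F)) (JW' : Matrix (Fin 1) (Fin 1) F)
    (hW' : TW'.IsSymm) (hWd' : IsUnit TW'.det) (hJW' : JW' = TW'.map (algebraMap ↥(maximalRealSubfield F) F))
    (hT : TW ↥(maximalRealSubfield F) (r.toFun ε) = TW') (hJ : JW ↥(maximalRealSubfield F) F (r.toFun ε) = JW')
    (hs' : (splittingDatum ↥(maximalRealSubfield F) F (IsCMField.complexConj F) 3 1 e (Matrix.diagonal dV) JW'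
        (complexConj_imagUnit F) (imagUnit_ne_zero F) (imagUnit_mul_self F) (realDiagonal_isSymm F dV hdV) hW'
        (isUnit_det_realDiagonal F dV hdV hdV0) hWd' (realDiagonal_map F dV hdV).symm hJW').IsCompatible
      (Def411WeilCarriersDoubling.chiSplittingLine F e dV hdV hdV0 (toHeckeCharacter F μ) (isUnitary_toHeckeCharacter F μ)
        ((isOscillatorChar_toHeckeCharacter_iff μ).mpr hμ) TW' hWd' JW' hJW'))
    (χ : {χ : ↥(UnitaryGroup.finAdelic ↥(maximalRealSubfield F) F (IsCMField.complexConj F) 1 JW') →* ℂˣ //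
      IsOpen ((χ.ker : Subgroup _) : Set ↥(UnitaryGroup.finAdelic ↥(maximalRealSubfield F) F (IsCMField.complexConj F) 1 JW')) ∧
        ∀ γ : UnitaryGroup.rational ↥(maximalRealSubfield F) F (IsCMField.complexConj F) 1 JW',
          χ (UnitaryGroup.rationalToFinAdelic ↥(maximalRealSubfield F) F (IsCMField.complexConj F) 1 JW' γ) = 1})
    (f : FinSB ↥(maximalRealSubfield F) (Fin 3 × Fin 1)) :
    omegaTransportAtDeltaPrime h F h6 ι₁ V Φ e dV hdV hdV0 ιV r μ hμ hw ε hε hΦ TW' JW' hW' hWd' hJW' hT hJ hs' χ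
        (Submodule.Quotient.mk f) = Submodule.Quotient.mk f := by
  subst hJ
  subst hT
  rfl

set_option maxHeartbeats 2000000 in
/-- **`he` — `e` is `𝔾(𝔸^∞)`-equivariant**: `e (g • m) = ρ(μ, ε, χ ∘ centre)(g) (e m)` for the `ℂ[U(V)(𝔸_f)]`-module structure of the package
carrier (`Representation.asModule`) and the action `rhoAt (σ χ)` of the Liu datum — both act on the class of `f` by the class of
`ω_f(s_pair(ιV g, 1)) f` (`weilCoinv_mk` on either side). [cite: Liu2021, Def. 4.11 (FJcycle.tex l. 2092–2096), App. D §D.1 Step 3 (l. 5221)] -/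
theorem omegaTransportAtDeltaPrime_smul (h : exists_recordSystem) (F : CMField) [IsGalois ℚ F] (h6 : 6 ≤ Module.finrank ℚ F)
    (ι₁ : F →+* ℂ) (V : HermSpace3 F ι₁) (Φ : CMType F) {n : ℕ} (e : Fin 3 × Fin 1 ≃ Fin n) (dV : Fin 3 → F)
    (hdV : ∀ i, IsCMField.complexConj F (dV i) = dV i) (hdV0 : ∀ i, dV i ≠ 0)
    (ιV : (sec42DataOf h isoOf F ι₁ V Φ).G →*
      UnitaryGroup.finAdelic ↥(maximalRealSubfield F) F (IsCMField.complexConj F) 3 (Matrix.diagonal dV))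
    (r : Rep ↥(maximalRealSubfield F) (imagUnitSq F))
    (μ : IdeleClassGroup F →ₜ* Circle) (hμ : IdeleClassGroup.IsConjugateSymplectic F μ) (hw : IdeleClassGroup.HasWeight F μ 1)
    (ε : Eps ↥(maximalRealSubfield F) (imagUnitSq F)) (hε : ∃ a, locF ↥(maximalRealSubfield F) (imagUnitSq F) a = ε)
    (hΦ : ∀ τ : F →+* ℂ, τ ∈ hμ.cmType.1 → 0 < (τ (imagUnit F * algebraMap ↥(maximalRealSubfield F) F (r.toFun ε))).im)
    (TW' : Matrix (Fin 1) (Fin 1) ↥(maximalRealSubfield F)) (JW' : Matrix (Fin 1) (Fin 1) F)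
    (hW' : TW'.IsSymm) (hWd' : IsUnit TW'.det) (hJW' : JW' = TW'.map (algebraMap ↥(maximalRealSubfield F) F))
    (hT : TW ↥(maximalRealSubfield F) (r.toFun ε) = TW') (hJ : JW ↥(maximalRealSubfield F) F (r.toFun ε) = JW')
    (hs' : (splittingDatum ↥(maximalRealSubfield F) F (IsCMField.complexConj F) 3 1 e (Matrix.diagonal dV) JW'
        (complexConj_imagUnit F) (imagUnit_ne_zero F) (imagUnit_mul_self F) (realDiagonal_isSymm F dV hdV) hW'
        (isUnit_det_realDiagonal F dV hdV hdV0) hWd' (realDiagonal_map F dV hdV).symm hJW').IsCompatible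
      (Def411WeilCarriersDoubling.chiSplittingLine F e dV hdV hdV0 (toHeckeCharacter F μ) (isUnitary_toHeckeCharacter F μ)
        ((isOscillatorChar_toHeckeCharacter_iff μ).mpr hμ) TW' hWd' JW' hJW'))
    (χ : {χ : ↥(UnitaryGroup.finAdelic ↥(maximalRealSubfield F) F (IsCMField.complexConj F) 1 JW') →* ℂˣ //
      IsOpen ((χ.ker : Subgroup _) : Set ↥(UnitaryGroup.finAdelic ↥(maximalRealSubfield F) F (IsCMField.complexConj F) 1 JW')) ∧
        ∀ γ : UnitaryGroup.rational ↥(maximalRealSubfield F) F (IsCMField.complexConj F) 1 JW',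
          χ (UnitaryGroup.rationalToFinAdelic ↥(maximalRealSubfield F) F (IsCMField.complexConj F) 1 JW' γ) = 1})
    (g : (sec42DataOf h isoOf F ι₁ V Φ).G)
    (m : Representation.asModule
        ((HodgeCM.WeilCoinv.weilCoinv ↥(maximalRealSubfield F) F (IsCMField.complexConj F) 3 1 e (Matrix.diagonal dV) JW'
          (complexConj_imagUnit F) (imagUnit_ne_zero F) (imagUnit_mul_self F) (realDiagonal_isSymm F dV hdV) hW'
          (isUnit_det_realDiagonal F dV hdV hdV0) hWd' (realDiagonal_map F dV hdV).symm hJW' χ.1 hs').comp ιV)) :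
    omegaTransportAtDeltaPrime h F h6 ι₁ V Φ e dV hdV hdV0 ιV r μ hμ hw ε hε hΦ TW' JW' hW' hWd' hJW' hT hJ hs' χ
        (MonoidAlgebra.of ℂ (sec42DataOf h isoOf F ι₁ V Φ).G g • m) =
      (toThm418Data (sec42DataOf h isoOf F ι₁ V Φ) (restOfCharDeltaPrime h F h6 ι₁ V Φ e dV hdV hdV0 ιV r μ hμ hw)).rhoAt
        (admIndexAtDeltaPrime h F h6 ι₁ V Φ e dV hdV hdV0 ιV r μ hμ hw ε hε hΦ JW' hJ χ) g
        (omegaTransportAtDeltaPrime h F h6 ι₁ V Φ e dV hdV hdV0 ιV r μ hμ hw ε hε hΦ TW' JW' hW' hWd' hJW' hT hJ hs' χ m) := by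
  subst hJ
  subst hT
  -- the `ℂ[G]`-scalar `of g` acts on the package carrier through the representation
  rw [of_smul_eq_asModule]
  obtain ⟨f, rfl⟩ := Submodule.Quotient.mk_surjective _ m
  rfl

end Transport

end Summit.HodgeConjecture.CorCM.Model

end
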